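import Literature.MathematicalPhysics.QuantumFieldTheory.Balaban1983to89.B15Eq177ValueInvariance
import Literature.MathematicalPhysics.QuantumFieldTheory.Balaban1983to89.B15Eq177GaugeInvarianceB
import Literature.MathematicalPhysics.QuantumFieldTheory.Balaban1983to89.Node00.SmallFieldChiOfRecordB

/-!
# `Balaban1983to89.B15Eq177ValueInvarianceB` — [Balaban1989LargeFieldI] (= [B15]) p. 194, the sentence after (1.77) *«The function is invariant with respect to the group of all gauge
# transformations defined on Λ»* AT THE TOTALISED (2.12) SOLUTION MAP OF RECORD OVER A **BOND-LEVEL DATUM** (node00-def-R's S2a `Node00.bgOfRecordB av reg` = `UminOfRecordB`, a chosen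
# `IsMinimizerB`-minimiser on `solvableDomB`, the unit configuration off it) — the print-datum parametrisation of `B15Eq177ValueInvariance` §1–§4: transport of (2.12) minimisers along gauge-
# related data over a bond datum, value invariance of `UminOfRecordB`, (1.77)'s gauge invariance for `fun177B ∕ fun177stdB` at `bgOfRecordB` WITHOUT (181), and the anti-vacuity certificate
# `not_cov181B_bgOfRecordB` (THEOREMS ONLY)

statement-level skeleton of published theorems with citation tags; proofs where landed; nothing here is a claim about
the Yang–Mills mass gap

Cell `pub-ymgap` (HUMAN RULINGS D-0062 ∕ D-0149), lane `pub-ymgap-dag-n12-c` g34 (R134 seat (a), N12 = [B15], s1); `--kind proof --supports` K1⁹ `stmt-QuantumFields-27364`;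
count-neutral.  THEOREMS ONLY (0 `def`, 0 `instance`, 0 `sorry`).  (E1) variant (iii-b), the lane's memo `N12-REATTACHMENT-DESIGN-2026-08-30.md` §7 step (4a): the first UPSTREAM twin the
record-keyed heads F1 ∕ F3 (`B15Prop1CoerciveEditionNearAtLength` ∕ `…WindowDirectPackageNearRadiusAtLength`) need (`fun177std_dichotomy ∕ fun177std_bgOfRecord_gaugeAct` live here and in
its siblings).

HONESTY GUARD (director-ym №338 (5)).  PURELY ADDITIVE: the (b)-instance module stays landed and true on its own text; every theorem below is its parametrisation in the determining datum
(`IsMinimizer ∕ AgreeOn ∕ solvableDom ∕ UminOfRecord ∕ bgOfRecord ∕ Cov181 ∕ fun177(std)` ↦ `IsMinimizerB ∕ AgreeOnB ∕ solvableDomB ∕ UminOfRecordB ∕ bgOfRecordB ∕ Cov181B ∕ fun177B(stdB)`)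
with the parent's proofs verbatim; the datum-free lemmas `related_symm ∕ gaugeAct_one_ne_one` of the parent are REUSED.  §5 of the parent (the multi-scale class of record
`Node00.bgMSOfRecord`) is not twinned here (its bond-level edition is node00-def-R's `bgMSCoPOfRecordAtB`; the consumer states it there).

WHAT IS HERE.
* §1 `agreeOnB_gaugeAct_of_related` · `isMinimizerB_gaugeAct_of_related` (transport of (2.12) minimisers along `ū`-related data, bond datum living in the standing range) ·
  `mem_solvableDomB_of_related ∕ _iff_of_related` · `wilsonAction4_eq_of_isMinimizerB`.
* §2 ★ `wilsonAction4_UminOfRecordB_of_related` — `A(U(𝔅, V′)) = A(U(𝔅, V))` for the totalised bond-level solution map of record (both branches).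
* §3 `bondsDet_genSet_eq_empty_of_gt` ∕ `lamBondsSeq_eq_empty_of_range` (no member above the standing range, both families) · ★★ `fun177B_bgOfRecordB_gaugeAct` ·
  `fun177stdB_bgOfRecordB_gaugeAct` · `gaugeInvariant_fun177stdB_bgOfRecordB` (p. 194's sentence at the bond-level map of record, any family `bd` empty above the range).
* §4 ★ `not_cov181B_bgOfRecordB` (the configuration-level (181) letter FAILS at the totalised map: anti-vacuity certificate for `Cov181B`).

HONEST SCOPE.  Elementary bookkeeping; nothing of [15] Thm 1 asserted or used; count-neutral; N12 NOT discharged; K0⁷ ∕ K1⁹ NOT closed; the Yang–Mills mass gap (Clay) is NOT proved by any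
of this.

References: [B15] = [Balaban1989LargeFieldI] (1.74) p.192, (1.77) p.194; [15] = [Balaban1985Variational] (181) p.307, p.278; [III] = [Balaban1988Convergent] (2.10)–(2.13) pp.256–257;
[II] = [Balaban1984PropagatorsII] (2.3) p.224; [Balaban1985Averaging] (8), (11) pp.18–19.
-/

noncomputable section

namespace Literature.MathematicalPhysics.QuantumFieldTheory.Balaban1983to89.B15Eq177ValueInvariance

open Literature.MathematicalPhysics.QuantumFieldTheory.Balaban1983to89
open B15DeterminingSets B15DeterminingSetsB B14.Eq213DetSet B14.Eq216Concrete GaugeField B16Sect1Backgrounds B15Eq177GaugeInvariance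
open B15Sect1Instances Node00
open Literature.MathematicalPhysics.QuantumFieldTheory.BalabanImbrieJaffe1984to88.BIJ85Eq453GaugeField

variable {P : Params} {G : Type*} [GaugeGroup G]

/-! ## §1  Data related by a gauge transformation of `T_η`, and the transport of (2.12) minimisers over a bond datum -/

/-- If `U₀` realises the data `V` on the bonds of `𝔅`, then `U₀^{ū}` realises the `ū`-related data `V′` there (`𝔅` living in the standing range; covariance of the averages,
`B16Sect1Backgrounds.iter_gaugeAct`) — twin of `agreeOn_gaugeAct_of_related`. [cite: Balaban1988Convergent, (2.10)–(2.12) p.256; Balaban1985Averaging, (11) p.19] -/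
theorem agreeOnB_gaugeAct_of_related (av : ∀ j, Averaging P j G) {𝔅 : BDetSet P} (h𝔅 : ∀ j, P.m + P.K < j → 𝔅 j = ∅)
    (ū : GaugeTransf P 0 G) {V V' : MSField P G} (hVV' : ∀ j, j ≤ P.m + P.K → V' j = gaugeAct (toMS ū j) (V j))
    {U₀ : GaugeField P 0 G} (h : AgreeOnB 𝔅 (avgFamily av U₀) V) :
    AgreeOnB 𝔅 (avgFamily av (gaugeAct ū U₀)) V' := by
  intro j b hb
  by_cases hj : j ≤ P.m + P.K
  · have h1 : avgFamily av (gaugeAct ū U₀) j = gaugeAct (toMS ū j) (avgFamily av U₀ j) := iter_gaugeAct av ū U₀ j hj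
    rw [h1, hVV' j hj]
    simp only [gaugeAct, h j b hb]
  · exfalso
    rw [h𝔅 j (not_le.1 hj)] at hb
    exact hb

/-- **TRANSPORT OF (2.12) MINIMISERS OVER A BOND DATUM**: for a gauge-invariant class `reg`, a minimiser under the constraints `M_𝔅(U) = V` gives the minimiser `U₀^{ū}` under `M_𝔅(U) = V′` for the
`ū`-related data — twin of `isMinimizer_gaugeAct_of_related`. [cite: Balaban1985Variational, (181) p.307; Balaban1988Convergent, (2.12) p.256] -/
theorem isMinimizerB_gaugeAct_of_related (av : ∀ j, Averaging P j G) {reg : Set (GaugeField P 0 G)}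
    (hreg : ∀ (w : GaugeTransf P 0 G) (U : GaugeField P 0 G), U ∈ reg → gaugeAct w U ∈ reg)
    {𝔅 : BDetSet P} (h𝔅 : ∀ j, P.m + P.K < j → 𝔅 j = ∅) (ū : GaugeTransf P 0 G) {V V' : MSField P G}
    (hVV' : ∀ j, j ≤ P.m + P.K → V' j = gaugeAct (toMS ū j) (V j)) {U₀ : GaugeField P 0 G}
    (h : IsMinimizerB av reg 𝔅 V U₀) : IsMinimizerB av reg 𝔅 V' (gaugeAct ū U₀) := by
  refine ⟨hreg ū U₀ h.1, agreeOnB_gaugeAct_of_related av h𝔅 ū hVV' h.2.1, fun U hU hUV => ?_⟩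
  have hUV' : AgreeOnB 𝔅 (avgFamily av (gaugeAct (invG ū) U)) V :=
    agreeOnB_gaugeAct_of_related av h𝔅 (invG ū) (related_symm ū hVV') hUV
  have hle := h.2.2 (gaugeAct (invG ū) U) (hreg _ U hU) hUV'
  rw [B14Eq16FaddeevPopov.wilsonAction4_gaugeAct'] at hle
  rw [B14Eq16FaddeevPopov.wilsonAction4_gaugeAct']
  exact hle

/-- The solvable sets of `ū`-related data coincide (one direction), bond datum. [cite: Balaban1988Convergent, (2.12) p.256] -/
theorem mem_solvableDomB_of_related (av : ∀ j, Averaging P j G) {reg : Set (GaugeField P 0 G)}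
    (hreg : ∀ (w : GaugeTransf P 0 G) (U : GaugeField P 0 G), U ∈ reg → gaugeAct w U ∈ reg)
    {𝔅 : BDetSet P} (h𝔅 : ∀ j, P.m + P.K < j → 𝔅 j = ∅) (ū : GaugeTransf P 0 G) {V V' : MSField P G}
    (hVV' : ∀ j, j ≤ P.m + P.K → V' j = gaugeAct (toMS ū j) (V j)) (hV : V ∈ solvableDomB av reg 𝔅) :
    V' ∈ solvableDomB av reg 𝔅 := by
  obtain ⟨U₀, hU₀⟩ := hV
  exact ⟨_, isMinimizerB_gaugeAct_of_related av hreg h𝔅 ū hVV' hU₀⟩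

/-- The solvable sets of `ū`-related data coincide, bond datum. [cite: Balaban1988Convergent, (2.12) p.256] -/
theorem mem_solvableDomB_iff_of_related (av : ∀ j, Averaging P j G) {reg : Set (GaugeField P 0 G)}
    (hreg : ∀ (w : GaugeTransf P 0 G) (U : GaugeField P 0 G), U ∈ reg → gaugeAct w U ∈ reg)
    {𝔅 : BDetSet P} (h𝔅 : ∀ j, P.m + P.K < j → 𝔅 j = ∅) (ū : GaugeTransf P 0 G) {V V' : MSField P G}
    (hVV' : ∀ j, j ≤ P.m + P.K → V' j = gaugeAct (toMS ū j) (V j)) :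
    V' ∈ solvableDomB av reg 𝔅 ↔ V ∈ solvableDomB av reg 𝔅 :=
  ⟨mem_solvableDomB_of_related av hreg h𝔅 (invG ū) (related_symm ū hVV'), mem_solvableDomB_of_related av hreg h𝔅 ū hVV'⟩

/-- Two minimisers of ONE (2.12) problem over a bond datum have the same action. [cite: Balaban1988Convergent, (2.12) p.256] -/
theorem wilsonAction4_eq_of_isMinimizerB (av : ∀ j, Averaging P j G) {reg : Set (GaugeField P 0 G)} {𝔅 : BDetSet P}
    {V : MSField P G} {U₀ U₁ : GaugeField P 0 G} (h₀ : IsMinimizerB av reg 𝔅 V U₀) (h₁ : IsMinimizerB av reg 𝔅 V U₁) :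
    wilsonAction4 U₀ = wilsonAction4 U₁ :=
  le_antisymm (h₀.2.2 U₁ h₁.1 h₁.2.1) (h₁.2.2 U₀ h₀.1 h₀.2.1)

/-! ## §2  The totalised bond-level solution map of record: `A(U(𝔅, V′)) = A(U(𝔅, V))` for related data -/

section SolutionMapB

variable [MeasurableSpace G]

/-- **VALUE INVARIANCE OF node00-def-R's BOND-LEVEL (2.12) SOLUTION MAP OF RECORD** `Node00.UminOfRecordB` (S2a): for `ū`-related data its Wilson actions agree — on the solvable set both
values are the common minimum (§1), off it both are the unit; twin of `wilsonAction4_UminOfRecord_of_related`. [cite: Balaban1988Convergent, (2.12) p.256; Balaban1985Variational, (181) p.307] -/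
theorem wilsonAction4_UminOfRecordB_of_related (av : ∀ j, Averaging P j G) {reg : Set (GaugeField P 0 G)}
    (hreg : ∀ (w : GaugeTransf P 0 G) (U : GaugeField P 0 G), U ∈ reg → gaugeAct w U ∈ reg)
    {𝔅 : BDetSet P} (h𝔅 : ∀ j, P.m + P.K < j → 𝔅 j = ∅) (ū : GaugeTransf P 0 G) {V V' : MSField P G}
    (hVV' : ∀ j, j ≤ P.m + P.K → V' j = gaugeAct (toMS ū j) (V j)) :
    wilsonAction4 (UminOfRecordB av reg 𝔅 V') = wilsonAction4 (UminOfRecordB av reg 𝔅 V) := by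
  by_cases hV : ∃ U₀, IsMinimizerB av reg 𝔅 V U₀
  · obtain ⟨U₀, hU₀⟩ := hV
    have h1 : IsMinimizerB av reg 𝔅 V (UminOfRecordB av reg 𝔅 V) := Node00.isMinimizerB_UminOfRecordB av reg ⟨U₀, hU₀⟩
    have h2 : IsMinimizerB av reg 𝔅 V' (UminOfRecordB av reg 𝔅 V') :=
      Node00.isMinimizerB_UminOfRecordB av reg ⟨_, isMinimizerB_gaugeAct_of_related av hreg h𝔅 ū hVV' hU₀⟩
    have h3 : IsMinimizerB av reg 𝔅 V' (gaugeAct ū (UminOfRecordB av reg 𝔅 V)) :=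
      isMinimizerB_gaugeAct_of_related av hreg h𝔅 ū hVV' h1
    rw [wilsonAction4_eq_of_isMinimizerB av h2 h3, B14Eq16FaddeevPopov.wilsonAction4_gaugeAct']
  · have hV' : ¬ ∃ U₀, IsMinimizerB av reg 𝔅 V' U₀ := fun ⟨U₀, hU₀⟩ =>
      hV ⟨_, isMinimizerB_gaugeAct_of_related av hreg h𝔅 (invG ū) (related_symm ū hVV') hU₀⟩
    rw [Node00.UminOfRecordB_of_not av reg hV, Node00.UminOfRecordB_of_not av reg hV']

end SolutionMapB

/-! ## §3  p. 194's sentence at the bond-level map of record, for (1.77) over `(bgOfRecordB, 𝔅)` and the family instances -/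

section Eq177B

variable [MeasurableSpace G]

/-- No member of reading (b)'s datum of `{Ω_j}` above the length `k` (hence none above the standing range when `k ≤ m + K`). [cite: Balaban1988Convergent, (2.2) p.255 (bookkeeping)] -/
theorem bondsDet_genSet_eq_empty_of_gt (Ω : ℕ → Set (Site P 0)) {k j : ℕ} (hkj : k < j) : bondsDet (genSet Ω k) j = ∅ := by
  rw [bondsDet_apply]
  ext b
  simp [bondsOf, genSet, gammaRegion_of_gt Ω hkj, pts]

/-- No member of print's datum of `{Ω_j}` above the length `k` (F0a `lamBondsSeq_of_gt`). [cite: Balaban1984PropagatorsII, (2.3) p.224 (bookkeeping)] -/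
theorem lamBondsSeq_eq_empty_of_range (Ω : ℕ → Set (Site P 0)) {k : ℕ} (hk : k ≤ P.m + P.K) : ∀ j, P.m + P.K < j → lamBondsSeq Ω k j = ∅ :=
  fun _ hj => lamBondsSeq_of_gt Ω k (lt_of_le_of_lt hk hj)

/-- **(1.77) IS GAUGE INVARIANT AT THE BOND-LEVEL SOLUTION MAP OF RECORD**: `A(U_{k,Z}(V_k^u)) = A(U_{k,Z}(V_k))` for every gauge transformation `u` of `T^{(k)}` (`k ≤ m + K`), `U_{k,Z} = U(𝔅,
M˙(Q_k^{s*}·))` with `U := Node00.bgOfRecordB av reg`, a gauge-invariant class `reg` and a bond datum `𝔅` empty above the standing range — WITHOUT (181): `Q_k^{s*}(V^u) = (Q_k^{s*}V)^{ū}`,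
`M˙((·)^{ū}) = M˙(·)^{ū↾}`, then §2; twin of `fun177_bgOfRecord_gaugeAct`. [cite: Balaban1989LargeFieldI, (1.77) p.194; Balaban1984PropagatorsII, (2.3) p.224] -/
theorem fun177B_bgOfRecordB_gaugeAct (av : ∀ j, Averaging P j G) {reg : Set (GaugeField P 0 G)}
    (hreg : ∀ (w : GaugeTransf P 0 G) (U : GaugeField P 0 G), U ∈ reg → gaugeAct w U ∈ reg)
    (𝔅 : BDetSet P) (h𝔅 : ∀ j, P.m + P.K < j → 𝔅 j = ∅) {k : ℕ} (hk : k ≤ P.m + P.K) (u : GaugeTransf P k G) (Vk : GaugeField P k G) :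
    fun177B (bgOfRecordB av reg) 𝔅 (qsstarGIter0 k) (gaugeAct u Vk) = fun177B (bgOfRecordB av reg) 𝔅 (qsstarGIter0 k) Vk := by
  unfold fun177B bgKZB
  rw [Node00.bgOfRecordB_U, qsstarGIter0_gaugeAct k hk u Vk]
  exact wilsonAction4_UminOfRecordB_of_related av hreg h𝔅 (blockLift k u) (fun j hj => iter_gaugeAct av (blockLift k u) (qsstarGIter0 k Vk) j hj)

/-- **p. 194'S SENTENCE AT THE BOND-LEVEL MAP OF RECORD, family instance `fun177stdB`**: `A(U_{k,Z}(V_k^u)) = A(U_{k,Z}(V_k))` for every gauge transformation `u` of `T^{(k)}`, at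
`bgOfRecordB av reg`, over ANY gauge-invariant class `reg` and any bond-datum family `bd` empty above the standing range at `(k, maxDomT M₁ Z)` (both families of record are: §3's two lemmas);
twin of `fun177std_bgOfRecord_gaugeAct`. [cite: Balaban1989LargeFieldI, (1.77) p.194; Balaban1984PropagatorsII, (2.3) p.224] -/
theorem fun177stdB_bgOfRecordB_gaugeAct (av : ∀ j, Averaging P j G) {reg : Set (GaugeField P 0 G)}
    (hreg : ∀ (w : GaugeTransf P 0 G) (U : GaugeField P 0 G), U ∈ reg → gaugeAct w U ∈ reg)
    (M₁ : ℕ) (bd : ℕ → (ℕ → Set (Site P 0)) → BDetSet P) (Z : Set (Site P 0)) {k : ℕ} (hk : k ≤ P.m + P.K)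
    (hbd : ∀ j, P.m + P.K < j → bd k (maxDomT M₁ Z) j = ∅) (u : GaugeTransf P k G) (Vk : GaugeField P k G) :
    fun177stdB (bgOfRecordB av reg) M₁ bd Z k (gaugeAct u Vk) = fun177stdB (bgOfRecordB av reg) M₁ bd Z k Vk :=
  fun177B_bgOfRecordB_gaugeAct av hreg (bd k (maxDomT M₁ Z)) hbd hk u Vk

/-- (1.77) at the bond-level map of record as `GaugeField.GaugeInvariant`. [cite: Balaban1989LargeFieldI, (1.77) p.194] -/
theorem gaugeInvariant_fun177stdB_bgOfRecordB (av : ∀ j, Averaging P j G) {reg : Set (GaugeField P 0 G)}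
    (hreg : ∀ (w : GaugeTransf P 0 G) (U : GaugeField P 0 G), U ∈ reg → gaugeAct w U ∈ reg)
    (M₁ : ℕ) (bd : ℕ → (ℕ → Set (Site P 0)) → BDetSet P) (Z : Set (Site P 0)) {k : ℕ} (hk : k ≤ P.m + P.K)
    (hbd : ∀ j, P.m + P.K < j → bd k (maxDomT M₁ Z) j = ∅) : GaugeInvariant (fun177stdB (bgOfRecordB av reg) M₁ bd Z k) :=
  fun u Vk => fun177stdB_bgOfRecordB_gaugeAct av hreg M₁ bd Z hk hbd u Vk

/-- The range hypothesis `hbd` at reading (b)'s family (`Bj M₁ Z k = genSet (maxDomT M₁ Z) k`). [cite: Balaban1988Convergent, (2.13) pp.256–257 (bookkeeping)] -/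
theorem genSetDatumP_eq_empty_of_range (M₁ : ℕ) (Z : Set (Site P 0)) {k : ℕ} (hk : k ≤ P.m + P.K) :
    ∀ j, P.m + P.K < j → (genSetDatumP k (maxDomT M₁ Z) : BDetSet P) j = ∅ := fun _ hj =>
  bondsDet_genSet_eq_empty_of_gt _ (lt_of_le_of_lt hk hj)

/-- The range hypothesis `hbd` at print's family. [cite: Balaban1984PropagatorsII, (2.3) p.224 (bookkeeping)] -/
theorem lamDatumP_eq_empty_of_range (M₁ : ℕ) (Z : Set (Site P 0)) {k : ℕ} (hk : k ≤ P.m + P.K) :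
    ∀ j, P.m + P.K < j → (lamDatumP k (maxDomT M₁ Z) : BDetSet P) j = ∅ :=
  lamBondsSeq_eq_empty_of_range _ hk

end Eq177B

/-! ## §4  Anti-vacuity: the configuration-level (181) letter `Cov181B` FAILS at the totalised bond-level map of record -/

/-- **THE CONFIGURATION-LEVEL (181) LETTER IS NOT SATISFIABLE AT THE BOND-LEVEL MAP OF RECORD**: if some datum `V` is unsolvable for `𝔅` in `reg` and `ū` moves the unit configuration, then
`Cov181B (bgOfRecordB av reg) 𝔅 ū` is FALSE (both values of the totalised map are the unit and `1 ≠ 1^{ū}`); twin of `not_cov181_bgOfRecord` — the VALUE invariance §3 is what survives.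
[cite: Balaban1985Variational, (181) p.307; Balaban1988Convergent, (2.12) p.256] -/
theorem not_cov181B_bgOfRecordB [MeasurableSpace G] (av : ∀ j, Averaging P j G) {reg : Set (GaugeField P 0 G)}
    (hreg : ∀ (w : GaugeTransf P 0 G) (U : GaugeField P 0 G), U ∈ reg → gaugeAct w U ∈ reg)
    {𝔅 : BDetSet P} (h𝔅 : ∀ j, P.m + P.K < j → 𝔅 j = ∅) {ū : GaugeTransf P 0 G}
    (hū : gaugeAct ū (fun _ : PBond P 0 => (1 : G)) ≠ fun _ => 1) {V : MSField P G} (hV : V ∉ solvableDomB av reg 𝔅) :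
    ¬ Cov181B (bgOfRecordB av reg) 𝔅 ū := by
  intro h
  have hV0 : ¬ ∃ U₀, IsMinimizerB av reg 𝔅 V U₀ := hV
  have hVV' : ∀ j, j ≤ P.m + P.K → msGaugeAct (toMS ū) V j = gaugeAct (toMS ū j) (V j) := fun j _ => rfl
  have hV' : ¬ ∃ U₀, IsMinimizerB av reg 𝔅 (msGaugeAct (toMS ū) V) U₀ := fun ⟨U₀, hU₀⟩ =>
    hV0 ⟨_, isMinimizerB_gaugeAct_of_related av hreg h𝔅 (invG ū) (related_symm ū hVV') hU₀⟩
  have hcov := h V (msGaugeAct (toMS ū) V) hVV'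
  rw [Node00.bgOfRecordB_U, Node00.UminOfRecordB_of_not av reg hV0, Node00.UminOfRecordB_of_not av reg hV'] at hcov
  exact hū hcov.symm

end Literature.MathematicalPhysics.QuantumFieldTheory.Balaban1983to89.B15Eq177ValueInvariance

end
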